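import Summits.QuantumFields.YangMills.Theorems.VirialFluxGapFixCoordPhasePackage
import Summits.QuantumFields.YangMills.Theorems.VirialFluxGapFixTubeFloor
import Summits.QuantumFields.YangMills.Theorems.LuscherReductionRunningReductionAxialConj
import Summits.QuantumFields.YangMills.Theorems.LuscherReductionTwistedTraceScalingBTCoreWeight
import HarnessLib

/-!
# The tubes of DISTINCT zero orbits are disjoint — `hdisj` of ✓`sharpTwistedLaplace_of_fixTubes`, with the correct orbit indexing
# (item (R6) of the DIRECT Laplace road to ⟨stmt-QuantumFields-24204⟩ `VirialFluxGap.SharpTwistedLaplace`)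

Helper module (free-hands work of width seat ym-line-sfw-p2-w2 g50, cell ym-idea-1; `--supports 24204`).  CAVEAT FIRST: the eight sign classes
`s : Fin 3 → Bool` label only FOUR zero orbits — conjugation by `C₀` flips `N₀ ↦ −N₀` on every wrapping link, so `SU(2)·Q_s = SU(2)·Q_{s ⊕ z}`; orbits are
labelled faithfully by the classes with a fixed value at the anchor direction `k₀` (`z k₀ = true`).  For two classes `s ≠ s′` with `s k₀ = s′ k₀` this file proves:
* §1 the squared chordal ring distance on `X_fix` in `Σ‖·‖²` form (`ringDistSq_fix_eq_sum`), its symmetry, the quasi-triangle inequality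
  `S(a,c) ≤ 2S(a,b) + 2S(b,c)` and its invariance under the residual conjugation;
* §2 (✓`T4QuatExpLog.norm_exp_sub_one_le`) ★ the TUBE RADIUS `S(k·σ_s(fixCoord v), k·Q_s) ≤ ‖v‖²`;
* §3 ★ the ORBIT SEPARATION `S(Q_s, k·Q_{s′}) ≥ 4` for every `k` (the `k₀`-link and a link where `s, s′` differ: parallelogram law);
* §4 ★★ `fixTubes_disjoint` — for `R_V < 1` the tubes `Θ_s(SU(2) × B̄(0,R_V))` and `Θ_{s′}(SU(2) × B̄(0,R_V))` (literally the sets of ✓`FixSplit.fix_hT`) are DISJOINT.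
Everything here is PROVED; no definitions (namespace `Summit.QuantumFields.YangMills.Theorems.VirialFluxGap.AnchorSlice`).

HONEST FRAMING: bookkeeping; ⟨24204⟩, ⟨24319⟩, ⟨22884⟩ and every rung stay OPEN; the Yang–Mills mass gap (Clay) is NOT touched; no summit is proved by a line.

## References
* G. E. Bredon, *Introduction to Compact Transformation Groups* (1972), Ch. II §§4–5. [Bredon1972]
* M. Lüscher, Nucl. Phys. B219 (1983), §2. [Luscher1983]
-/

set_option autoImplicit false

noncomputable section

open scoped Quaternion RealInnerProductSpace BigOperators
open NormedSpace Metric Set WithLp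
open Literature.MathematicalPhysics.QuantumFieldTheory hiding SU2 su2Quat_mul
open Literature.MathematicalPhysics.QuantumLattice
open Literature.MathematicalPhysics.QuantumFieldTheory.Balaban1983to89.T4HaarSU2Translate (su2Quat_mul)
open Literature.MathematicalPhysics.QuantumFieldTheory.Balaban1983to89.T4WilsonLinkAffine (su2Quat_inv)
open Literature.MathematicalPhysics.QuantumFieldTheory.Balaban1983to89.T4HaarSU2ExpChart
open Literature.MathematicalPhysics.QuantumFieldTheory.Balaban1983to89.T4ExpWindowSmallField (norm_sub_one_sq)
open Summit.QuantumFields.YangMills.Theorems.FemtoTransferGap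
open Summit.QuantumFields.YangMills.Theorems.FemtoTransferGap.TT
open Summit.QuantumFields.YangMills.Theorems.FemtoTransferGap.TwoLattice
open Summit.QuantumFields.YangMills.Theorems.FemtoTransferGap.TwoLattice.Flat
open Summit.QuantumFields.YangMills.Theorems.ToronValleyVolume.Lojasiewicz
open Summit.QuantumFields.YangMills.Theorems.TwistEaterVolume.Quadratic
open Summit.QuantumFields.YangMills.Theorems.VirialFluxGap.RingDeficit
open Summit.QuantumFields.YangMills.Theorems.VirialFluxGap.FixSplit
open Summit.QuantumFields.YangMills.Theorems.FemtoTransferGap.TwoLattice.ConstTube (re_trace_su2Rep_mul_inv_eq_norm norm_su2Quat_conj_sub_conj)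
open Literature.MathematicalPhysics.QuantumFieldTheory.Balaban1983to89 (T4QuatExpLog.norm_exp_sub_one_le)
open Summit.QuantumFields.YangMills.Theorems.QuantitativeLaplace (not_treeEdge_wrap su2Quat_centreElem)

namespace Summit.QuantumFields.YangMills.Theorems.VirialFluxGap.AnchorSlice

variable {L : ℕ} [NeZero L]

/-! ## §1 The squared chordal ring distance in `Σ‖·‖²` form -/

/-- The squared chordal ring distance of ✓`ringDeficit_fix_floor` as a sum of squared `su2Quat` distances. [folklore] -/
theorem ringDistSq_fix_eq_sum (x x' : (OffIdx L → SU2) × ((Fin (2 * L - 1) → GaugeConfig 3 L SU2) × (Site 3 L → SU2))) :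
    (∑ i : Fin (2 * L - 1 + 1), (6 * (L : ℝ) ^ 3 - timeCoupling su2Rep
        ((Fin.cons (glue x.1) x.2.1 : Fin (2 * L - 1 + 1) → GaugeConfig 3 L SU2) i)
        ((Fin.cons (glue x'.1) x'.2.1 : Fin (2 * L - 1 + 1) → GaugeConfig 3 L SU2) i))) +
        ∑ y : Site 3 L, (2 - ((su2Rep (x.2.2 y * (x'.2.2 y)⁻¹)).trace).re) =
      (∑ i : Fin (2 * L - 1 + 1), ∑ e : Edge 3 L, ‖su2Quat ((Fin.cons (glue x.1) x.2.1 : Fin (2 * L - 1 + 1) → GaugeConfig 3 L SU2) i e) -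
          su2Quat ((Fin.cons (glue x'.1) x'.2.1 : Fin (2 * L - 1 + 1) → GaugeConfig 3 L SU2) i e)‖ ^ 2) +
        ∑ y : Site 3 L, ‖su2Quat (x.2.2 y) - su2Quat (x'.2.2 y)‖ ^ 2 := by
  congr 1
  · exact Finset.sum_congr rfl fun i _ => timeCoupling_deficit_eq _ _
  · exact Finset.sum_congr rfl fun y _ => by rw [re_trace_su2Rep_mul_inv_eq_norm]; ring

/-- Quasi-triangle inequality for squared distances: `‖p − r‖² ≤ 2‖p − q‖² + 2‖q − r‖²`. [folklore] -/
theorem norm_sub_sq_le_two_mul (p q r : ℍ) : ‖p - r‖ ^ 2 ≤ 2 * ‖p - q‖ ^ 2 + 2 * ‖q - r‖ ^ 2 := by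
  have h := norm_add_le (p - q) (q - r)
  rw [show p - q + (q - r) = p - r by abel] at h
  have h0 := norm_nonneg (p - r)
  have h1 : ‖p - r‖ ^ 2 ≤ (‖p - q‖ + ‖q - r‖) ^ 2 := pow_le_pow_left₀ h0 h 2
  nlinarith [sq_nonneg (‖p - q‖ - ‖q - r‖)]

omit [NeZero L] in
/-- The glued ring of a conjugated point is the conjugated glued ring, linkwise. [folklore] -/
theorem cons_glue_conj_apply (k : SU2) (x : (OffIdx L → SU2) × ((Fin (2 * L - 1) → GaugeConfig 3 L SU2) × (Site 3 L → SU2)))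
    (i : Fin (2 * L - 1 + 1)) (e : Edge 3 L) :
    (Fin.cons (glue fun i : OffIdx L => k * x.1 i * k⁻¹) (fun j => gaugeTransform (fun _ : Site 3 L => k) (x.2.1 j)) :
        Fin (2 * L - 1 + 1) → GaugeConfig 3 L SU2) i e =
      k * (Fin.cons (glue x.1) x.2.1 : Fin (2 * L - 1 + 1) → GaugeConfig 3 L SU2) i e * k⁻¹ := by
  refine Fin.cases ?_ (fun j => ?_) i
  · rw [Fin.cons_zero, Fin.cons_zero, glue_conj']; rfl
  · rw [Fin.cons_succ, Fin.cons_succ]; rfl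

/-! ## §2 The tube radius -/

/-- A left exponential factor moves a unit quaternion by at most the exponent: `‖e^u q − q‖ ≤ ‖u‖`. [folklore] -/
theorem norm_exp_mul_sub_le {u : ℍ} (hu : u.re = 0) (q : SU2) : ‖exp u * su2Quat q - su2Quat q‖ ≤ ‖u‖ := by
  have e : exp u * su2Quat q - su2Quat q = (exp u - 1) * su2Quat q := by rw [sub_mul, one_mul]
  rw [e, norm_mul, norm_su2Quat, mul_one]; exact T4QuatExpLog.norm_exp_sub_one_le hu

omit [NeZero L] in
/-- The glued base ring in `X_fix` letters is the constant ring `(W_s)_i`. [folklore] -/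
theorem cons_glue_reference (W : GaugeConfig 3 L SU2) (hW : ∀ e, treeEdge e = true → W e = 1) :
    (Fin.cons (glue fun i : OffIdx L => W i.1) (fun _ : Fin (2 * L - 1) => W) : Fin (2 * L - 1 + 1) → GaugeConfig 3 L SU2) = fun _ => W := by
  have hglue : glue (fun i : OffIdx L => W i.1) = W := by
    funext e
    by_cases he : treeEdge e = true
    · rw [glue_apply_of_tree _ he, hW e he]
    · rw [glue_apply_of_not_tree _ he]
  rw [hglue]; funext i; exact Fin.cases rfl (fun _ => rfl) i

/-- ★ **Tube radius**: the slice point `σ_s(fixCoord v)` is within squared chordal ring distance `‖v‖²` of the base point `Q_s`, and so is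
`k·σ_s(fixCoord v)` of `k·Q_s`. [cite: Bredon1972, Ch. II §4] -/
theorem ringDistSq_fixSlice_reference_le (hL : 2 ≤ L) (z : Fin 3 → Bool) {k₀ : Fin 3} (hk₀ : z k₀ = true)
    {lam : Site 3 L → SU2} (hlam0 : lam 0 = 1) {N₀ C₀ : SU2}
    {ωC ωN ωX : EuclideanSpace ℝ (Fin 3)} (hCω : ‖ωC‖ = 1) (hNω : ‖ωN‖ = 1) (hX : imQuat ωX = imQuat ωC * imQuat ωN) (s : Fin 3 → Bool)
    {R : FixRest L ⟨(((fun _ => (-1 : ZMod L)), k₀) : Edge 3 L), not_treeEdge_wrap hL k₀⟩ 0}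
    (hR1 : ∀ i, R.1 i = combFlat (fun a => centreElem (s a) * (if z a then N₀ else 1)) i.1.1)
    (hR2 : ∀ j e, R.2.1 j e = combFlat (fun a => centreElem (s a) * (if z a then N₀ else 1)) e)
    (hR3 : ∀ x, R.2.2 x = lam x.1 * C₀) (k : SU2)
    (v : EuclideanSpace ℝ (Fin (fixDim L ⟨(((fun _ => (-1 : ZMod L)), k₀) : Edge 3 L), not_treeEdge_wrap hL k₀⟩ 0))) :
    (∑ i : Fin (2 * L - 1 + 1), ∑ e : Edge 3 L,
        ‖su2Quat ((Fin.cons (glue fun i : OffIdx L => k * (fixSlice ωC ωN ωX C₀ (centreElem (s k₀) * N₀) R (fixCoord v)).1 i * k⁻¹)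
              (fun j => gaugeTransform (fun _ : Site 3 L => k) ((fixSlice ωC ωN ωX C₀ (centreElem (s k₀) * N₀) R (fixCoord v)).2.1 j)) :
              Fin (2 * L - 1 + 1) → GaugeConfig 3 L SU2) i e) -
          su2Quat ((Fin.cons (glue fun i : OffIdx L => k * combFlat (fun a => centreElem (s a) * (if z a then N₀ else 1)) i.1 * k⁻¹)
              (fun _ : Fin (2 * L - 1) => gaugeTransform (fun _ : Site 3 L => k) (combFlat (fun a => centreElem (s a) * (if z a then N₀ else 1)))) :
              Fin (2 * L - 1 + 1) → GaugeConfig 3 L SU2) i e)‖ ^ 2) +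
      ∑ y : Site 3 L, ‖su2Quat (k * (fixSlice ωC ωN ωX C₀ (centreElem (s k₀) * N₀) R (fixCoord v)).2.2 y * k⁻¹) - su2Quat (k * (lam y * C₀) * k⁻¹)‖ ^ 2 ≤
      ‖v‖ ^ 2 := by
  have hC0 : (imQuat ωC).re = 0 := imQuat_re ωC
  have hN0 : (imQuat ωN).re = 0 := imQuat_re ωN
  have hX1 : ‖ωX‖ = 1 := by rw [← norm_imQuat, hX, norm_mul, norm_imQuat, norm_imQuat, hCω, hNω, mul_one]
  have hNX : ⟪ωN, ωX⟫ = 0 := by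
    rw [← inner_imQuat_imQuat, hX, real_inner_comm]; exact inner_pure_mul_right hC0 hN0
  obtain ⟨W, hW⟩ : ∃ W : GaugeConfig 3 L SU2, W = combFlat (fun a => centreElem (s a) * (if z a then N₀ else 1)) := ⟨_, rfl⟩
  have hWtree : ∀ e, treeEdge e = true → W e = 1 := fun e he => by rw [hW, combFlat_apply_of_tree _ he]
  -- reference glued ring
  have hrefQ : (Fin.cons (glue fun i : OffIdx L => k * combFlat (fun a => centreElem (s a) * (if z a then N₀ else 1)) i.1 * k⁻¹)
      (fun _ : Fin (2 * L - 1) => gaugeTransform (fun _ : Site 3 L => k) (combFlat (fun a => centreElem (s a) * (if z a then N₀ else 1)))) :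
      Fin (2 * L - 1 + 1) → GaugeConfig 3 L SU2) = fun _ => gaugeTransform (fun _ : Site 3 L => k) W := by
    rw [← hW]
    have h := cons_glue_reference (L := L) (gaugeTransform (fun _ : Site 3 L => k) W) (fun e he => by
      show k * W e * k⁻¹ = 1; rw [hWtree e he]; group)
    exact h
  -- linkwise
  have hlink : ∀ i e, ‖su2Quat ((Fin.cons (glue fun i : OffIdx L => k * (fixSlice ωC ωN ωX C₀ (centreElem (s k₀) * N₀) R (fixCoord v)).1 i * k⁻¹)
        (fun j => gaugeTransform (fun _ : Site 3 L => k) ((fixSlice ωC ωN ωX C₀ (centreElem (s k₀) * N₀) R (fixCoord v)).2.1 j)) :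
        Fin (2 * L - 1 + 1) → GaugeConfig 3 L SU2) i e) - su2Quat ((fun _ : Fin (2 * L - 1 + 1) => gaugeTransform (fun _ : Site 3 L => k) W) i e)‖ ≤
      ‖sliceLetterA ωN ωX (fixCoord v) i e‖ := by
    intro i e
    rw [cons_glue_conj_apply]
    show ‖su2Quat (k * _ * k⁻¹) - su2Quat (k * W e * k⁻¹)‖ ≤ _
    rw [norm_su2Quat_conj_sub_conj, su2Quat_ring_fixSlice_link hL hk₀ hR1 hR2 (fixCoord v) i e, ← hW]
    exact norm_exp_mul_sub_le (sliceLetterA_re ωN ωX (fixCoord v) i e) (W e)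
  have hsite : ∀ y, ‖su2Quat (k * (fixSlice ωC ωN ωX C₀ (centreElem (s k₀) * N₀) R (fixCoord v)).2.2 y * k⁻¹) - su2Quat (k * (lam y * C₀) * k⁻¹)‖ ≤
      ‖sliceLetterB ωC (fixCoord v) y‖ := by
    intro y
    rw [norm_su2Quat_conj_sub_conj, su2Quat_fixSlice_seam hlam0 hR3 (centreElem (s k₀) * N₀) (fixCoord v) y]
    exact norm_exp_mul_sub_le (sliceLetterB_re ωC (fixCoord v) y) (lam y * C₀)
  rw [hrefQ, norm_sq_eq_sliceCoords v, ← sum_norm_sq_sliceLetter hCω hNω hX1 hNX (fixCoord v)]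
  gcongr with i _ e _ y _
  · exact hlink i e
  · exact hsite y

/-! ## §3 Separation of distinct orbits -/

/-- Parallelogram law in the form used for the separation. [folklore] -/
theorem norm_sub_sq_add_norm_add_sq (a b : ℍ) : ‖a - b‖ ^ 2 + ‖a + b‖ ^ 2 = 2 * ‖a‖ ^ 2 + 2 * ‖b‖ ^ 2 := by
  rw [← real_inner_self_eq_norm_sq, ← real_inner_self_eq_norm_sq, ← real_inner_self_eq_norm_sq a, ← real_inner_self_eq_norm_sq b,
    inner_sub_left, inner_sub_right, inner_sub_right, inner_add_left, inner_add_right, inner_add_right, real_inner_comm a b]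
  ring

/-- ★ **Orbit separation**: for sign classes `s ≠ s′` agreeing at the anchor direction `k₀`, the base ring `Q_s` is at squared chordal ring distance
`≥ 4` from EVERY translate `k·Q_{s′}` — already on slice `0`: the `k₀`-wrapping link carries `±N₀` in both, a differing wrapping link carries opposite
signs, and `‖n − κnκ*‖² + ‖n + κnκ*‖² = 4`. [cite: Luscher1983, §2] -/
theorem four_le_ringDistSq_reference_conj (z : Fin 3 → Bool) {k₀ : Fin 3} (hzk₀ : z k₀ = true) {N₀ : SU2}
    {s s' : Fin 3 → Bool} (hss' : s ≠ s') (hk₀ : s k₀ = s' k₀) (k : SU2) :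
    4 ≤ ∑ e : Edge 3 L, ‖su2Quat (combFlat (fun a => centreElem (s a) * (if z a then N₀ else 1)) e) -
        su2Quat (k * combFlat (fun a => centreElem (s' a) * (if z a then N₀ else 1)) e * k⁻¹)‖ ^ 2 := by
  -- a direction where the classes differ
  obtain ⟨k₁, hk₁⟩ : ∃ k₁, s k₁ ≠ s' k₁ := by
    by_contra h
    push Not at h
    exact hss' (funext h)
  have hk₁₀ : k₁ ≠ k₀ := fun h => hk₁ (by rw [h]; exact hk₀)
  have hne : (((fun _ => (-1 : ZMod L)), k₀) : Edge 3 L) ≠ (((fun _ => (-1 : ZMod L)), k₁) : Edge 3 L) := fun h => hk₁₀ (congrArg Prod.snd h).symm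
  have hval : ∀ (t : Fin 3 → Bool) (j : Fin 3), combFlat (fun a => centreElem (t a) * (if z a then N₀ else 1)) (((fun _ => (-1 : ZMod L)), j) : Edge 3 L) =
      centreElem (t j) * (if z j then N₀ else 1) := fun t j => by
    rw [combFlat_apply, if_pos (show ((fun _ => (-1 : ZMod L)) : Site 3 L) j = -1 from rfl)]
  have hconj : ∀ X : SU2, su2Quat (k * X * k⁻¹) = su2Quat k * su2Quat X * star (su2Quat k) := fun X => by
    rw [su2Quat_mul, su2Quat_mul, su2Quat_inv]
  have hκ1 : ‖su2Quat k‖ = 1 := norm_su2Quat k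
  have hn1 : ‖su2Quat N₀‖ = 1 := norm_su2Quat N₀
  have hκn : ‖su2Quat k * su2Quat N₀ * star (su2Quat k)‖ = 1 := by rw [norm_mul, norm_mul, norm_star, hκ1, hn1]; ring
  have hκ1κ : su2Quat k * 1 * star (su2Quat k) = 1 := by
    rw [mul_one, ← su2Quat_inv, ← su2Quat_mul, mul_inv_cancel, FemtoTransferGap.su2Quat_one]
  -- the sum dominates the two chosen terms
  have hsum := Finset.sum_le_sum_of_subset_of_nonneg
    (f := fun e : Edge 3 L => ‖su2Quat (combFlat (fun a => centreElem (s a) * (if z a then N₀ else 1)) e) -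
        su2Quat (k * combFlat (fun a => centreElem (s' a) * (if z a then N₀ else 1)) e * k⁻¹)‖ ^ 2)
    (Finset.subset_univ ({(((fun _ => (-1 : ZMod L)), k₀) : Edge 3 L), (((fun _ => (-1 : ZMod L)), k₁) : Edge 3 L)} : Finset (Edge 3 L)))
    (fun _ _ _ => by positivity)
  rw [Finset.sum_pair hne] at hsum
  refine le_trans ?_ hsum
  simp only [hval, hconj, su2Quat_centreElem_mul, if_pos hzk₀, ← hk₀]
  -- signs: the `k₀`-term is `‖n − κnκ*‖²`, the `k₁`-term is `‖m + κmκ*‖²`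
  have hsign0 : ∀ b : Bool, ‖(if b then (-1 : ℝ) else 1) • su2Quat N₀ - su2Quat k * ((if b then (-1 : ℝ) else 1) • su2Quat N₀) * star (su2Quat k)‖ =
      ‖su2Quat N₀ - su2Quat k * su2Quat N₀ * star (su2Quat k)‖ := fun b => by
    rw [mul_smul_comm, smul_mul_assoc, ← smul_sub, norm_smul]; cases b <;> simp
  have hsign1 : ∀ m : ℍ, ‖(if s k₁ then (-1 : ℝ) else 1) • m - su2Quat k * ((if s' k₁ then (-1 : ℝ) else 1) • m) * star (su2Quat k)‖ =
      ‖m + su2Quat k * m * star (su2Quat k)‖ := by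
    intro m
    have hopp : (if s' k₁ then (-1 : ℝ) else 1) = -(if s k₁ then (-1 : ℝ) else 1) := by
      revert hk₁; cases s k₁ <;> cases s' k₁ <;> simp
    rw [hopp, neg_smul, mul_neg, mul_smul_comm, neg_mul, smul_mul_assoc, sub_neg_eq_add, ← smul_add, norm_smul]
    cases s k₁ <;> simp
  rw [hsign0, hsign1]
  by_cases hz1 : z k₁ = true
  · rw [if_pos hz1]
    have hp := norm_sub_sq_add_norm_add_sq (su2Quat N₀) (su2Quat k * su2Quat N₀ * star (su2Quat k))
    rw [hn1, hκn] at hp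
    linarith
  · rw [if_neg hz1, FemtoTransferGap.su2Quat_one, hκ1κ]
    have h4 : ‖(1 : ℍ) + 1‖ ^ 2 = 4 := by
      rw [show (1 : ℍ) + 1 = ((2 : ℝ) : ℍ) by rw [← Quaternion.coe_one, ← Quaternion.coe_add]; norm_num, Quaternion.norm_coe]; norm_num
    rw [h4]
    linarith [sq_nonneg ‖su2Quat N₀ - su2Quat k * su2Quat N₀ * star (su2Quat k)‖]

/-! ## §4 Disjointness of the tubes of distinct orbits -/

/-- ★★ **Tubes of distinct zero orbits are disjoint.**  For sign classes `s ≠ s′` with `s k₀ = s′ k₀` (faithful orbit labels) and a slice radius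
`R_V < 1`, the tubes `Θ_s(SU(2) × B̄(0,R_V))` and `Θ_{s′}(SU(2) × B̄(0,R_V))` of ✓`FixSplit.fix_hT` do not meet (orbit separation `≥ 4` in squared chordal
ring distance versus tube radius `≤ R_V²`, quasi-triangle inequality). [cite: Bredon1972, Ch. II §§4–5] [cite: Luscher1983, §2] -/
theorem fixTubes_disjoint (hL : 2 ≤ L) (z : Fin 3 → Bool) {k₀ : Fin 3} (hk₀ : z k₀ = true)
    {lam : Site 3 L → SU2} (hlam0 : lam 0 = 1) {N₀ C₀ : SU2}
    {ωC ωN ωX : EuclideanSpace ℝ (Fin 3)} (hCω : ‖ωC‖ = 1) (hNω : ‖ωN‖ = 1) (hX : imQuat ωX = imQuat ωC * imQuat ωN)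
    (Rb : (Fin 3 → Bool) → FixRest L ⟨(((fun _ => (-1 : ZMod L)), k₀) : Edge 3 L), not_treeEdge_wrap hL k₀⟩ 0)
    (hRb1 : ∀ s i, (Rb s).1 i = combFlat (fun a => centreElem (s a) * (if z a then N₀ else 1)) i.1.1)
    (hRb2 : ∀ s j e, (Rb s).2.1 j e = combFlat (fun a => centreElem (s a) * (if z a then N₀ else 1)) e)
    (hRb3 : ∀ s x, (Rb s).2.2 x = lam x.1 * C₀)
    {s s' : Fin 3 → Bool} (hss' : s ≠ s') (hsk₀ : s k₀ = s' k₀) {RV : ℝ} (hRV : RV < 1) :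
    Disjoint
      ((fun q : SU2 × EuclideanSpace ℝ (Fin (fixDim L ⟨(((fun _ => (-1 : ZMod L)), k₀) : Edge 3 L), not_treeEdge_wrap hL k₀⟩ 0)) =>
        (((fun i => q.1 * (fixSlice ωC ωN ωX C₀ (centreElem (s k₀) * N₀) (Rb s) (fixCoord q.2)).1 i * q.1⁻¹),
          ((fun j => gaugeTransform (fun _ : Site 3 L => q.1) ((fixSlice ωC ωN ωX C₀ (centreElem (s k₀) * N₀) (Rb s) (fixCoord q.2)).2.1 j)),
            (fun y => q.1 * (fixSlice ωC ωN ωX C₀ (centreElem (s k₀) * N₀) (Rb s) (fixCoord q.2)).2.2 y * q.1⁻¹))) :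
          (OffIdx L → SU2) × ((Fin (2 * L - 1) → GaugeConfig 3 L SU2) × (Site 3 L → SU2)))) ''
        ((univ : Set SU2) ×ˢ closedBall (0 : EuclideanSpace ℝ (Fin (fixDim L ⟨(((fun _ => (-1 : ZMod L)), k₀) : Edge 3 L), not_treeEdge_wrap hL k₀⟩ 0))) RV))
      ((fun q : SU2 × EuclideanSpace ℝ (Fin (fixDim L ⟨(((fun _ => (-1 : ZMod L)), k₀) : Edge 3 L), not_treeEdge_wrap hL k₀⟩ 0)) =>
        (((fun i => q.1 * (fixSlice ωC ωN ωX C₀ (centreElem (s' k₀) * N₀) (Rb s') (fixCoord q.2)).1 i * q.1⁻¹),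
          ((fun j => gaugeTransform (fun _ : Site 3 L => q.1) ((fixSlice ωC ωN ωX C₀ (centreElem (s' k₀) * N₀) (Rb s') (fixCoord q.2)).2.1 j)),
            (fun y => q.1 * (fixSlice ωC ωN ωX C₀ (centreElem (s' k₀) * N₀) (Rb s') (fixCoord q.2)).2.2 y * q.1⁻¹))) :
          (OffIdx L → SU2) × ((Fin (2 * L - 1) → GaugeConfig 3 L SU2) × (Site 3 L → SU2)))) ''
        ((univ : Set SU2) ×ˢ closedBall (0 : EuclideanSpace ℝ (Fin (fixDim L ⟨(((fun _ => (-1 : ZMod L)), k₀) : Edge 3 L), not_treeEdge_wrap hL k₀⟩ 0))) RV)) := by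
  -- the squared chordal ring distance on `X_fix`
  obtain ⟨SS, hSS⟩ : ∃ SS : ((OffIdx L → SU2) × ((Fin (2 * L - 1) → GaugeConfig 3 L SU2) × (Site 3 L → SU2))) →
      ((OffIdx L → SU2) × ((Fin (2 * L - 1) → GaugeConfig 3 L SU2) × (Site 3 L → SU2))) → ℝ,
      SS = fun a b => (∑ i : Fin (2 * L - 1 + 1), ∑ e : Edge 3 L, ‖su2Quat ((Fin.cons (glue a.1) a.2.1 : Fin (2 * L - 1 + 1) → GaugeConfig 3 L SU2) i e) -
          su2Quat ((Fin.cons (glue b.1) b.2.1 : Fin (2 * L - 1 + 1) → GaugeConfig 3 L SU2) i e)‖ ^ 2) +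
        ∑ y : Site 3 L, ‖su2Quat (a.2.2 y) - su2Quat (b.2.2 y)‖ ^ 2 := ⟨_, rfl⟩
  have hsymm : ∀ a b, SS a b = SS b a := fun a b => by
    rw [hSS]; dsimp only
    congr 1
    · exact Finset.sum_congr rfl fun i _ => Finset.sum_congr rfl fun e _ => by rw [norm_sub_rev]
    · exact Finset.sum_congr rfl fun y _ => by rw [norm_sub_rev]
  have htri : ∀ a b c, SS a c ≤ 2 * SS a b + 2 * SS b c := fun a b c => by
    rw [hSS]; dsimp only
    rw [mul_add, mul_add, add_add_add_comm, Finset.mul_sum, Finset.mul_sum, Finset.mul_sum, Finset.mul_sum, ← Finset.sum_add_distrib,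
      ← Finset.sum_add_distrib]
    gcongr with i _ y _
    · rw [Finset.mul_sum, Finset.mul_sum, ← Finset.sum_add_distrib]
      exact Finset.sum_le_sum fun e _ => norm_sub_sq_le_two_mul _ _ _
    · exact norm_sub_sq_le_two_mul _ _ _
  -- base points
  obtain ⟨Q, hQ⟩ : ∃ Q : (Fin 3 → Bool) → SU2 → ((OffIdx L → SU2) × ((Fin (2 * L - 1) → GaugeConfig 3 L SU2) × (Site 3 L → SU2))),
      Q = fun t k => ((fun i => k * combFlat (fun a => centreElem (t a) * (if z a then N₀ else 1)) i.1 * k⁻¹),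
        ((fun _ : Fin (2 * L - 1) => gaugeTransform (fun _ : Site 3 L => k) (combFlat (fun a => centreElem (t a) * (if z a then N₀ else 1)))),
          (fun y => k * (lam y * C₀) * k⁻¹))) := ⟨_, rfl⟩
  -- tube radius
  have hrad : ∀ (t : Fin 3 → Bool) (k : SU2) (v : EuclideanSpace ℝ (Fin (fixDim L ⟨(((fun _ => (-1 : ZMod L)), k₀) : Edge 3 L), not_treeEdge_wrap hL k₀⟩ 0))),
      SS ((((fun i => k * (fixSlice ωC ωN ωX C₀ (centreElem (t k₀) * N₀) (Rb t) (fixCoord v)).1 i * k⁻¹),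
          ((fun j => gaugeTransform (fun _ : Site 3 L => k) ((fixSlice ωC ωN ωX C₀ (centreElem (t k₀) * N₀) (Rb t) (fixCoord v)).2.1 j)),
            (fun y => k * (fixSlice ωC ωN ωX C₀ (centreElem (t k₀) * N₀) (Rb t) (fixCoord v)).2.2 y * k⁻¹))) :
          (OffIdx L → SU2) × ((Fin (2 * L - 1) → GaugeConfig 3 L SU2) × (Site 3 L → SU2)))) (Q t k) ≤ ‖v‖ ^ 2 := by
    intro t k v
    rw [hSS, hQ]; dsimp only
    exact ringDistSq_fixSlice_reference_le hL z hk₀ hlam0 hCω hNω hX t (hRb1 t) (hRb2 t) (hRb3 t) k v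
  -- orbit separation
  have hsep : ∀ k k' : SU2, 4 ≤ SS (Q s k) (Q s' k') := by
    intro k k'
    rw [hSS, hQ]; dsimp only
    have hWtree : ∀ (t : Fin 3 → Bool) (e : Edge 3 L), treeEdge e = true → combFlat (fun a => centreElem (t a) * (if z a then N₀ else 1)) e = 1 :=
      fun t e he => combFlat_apply_of_tree _ he
    have href : ∀ (t : Fin 3 → Bool) (k : SU2),
        (Fin.cons (glue fun i : OffIdx L => k * combFlat (fun a => centreElem (t a) * (if z a then N₀ else 1)) i.1 * k⁻¹)
          (fun _ : Fin (2 * L - 1) => gaugeTransform (fun _ : Site 3 L => k) (combFlat (fun a => centreElem (t a) * (if z a then N₀ else 1)))) :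
          Fin (2 * L - 1 + 1) → GaugeConfig 3 L SU2) =
        fun _ => gaugeTransform (fun _ : Site 3 L => k) (combFlat (fun a => centreElem (t a) * (if z a then N₀ else 1))) := fun t k =>
      cons_glue_reference (L := L) (gaugeTransform (fun _ : Site 3 L => k) _) (fun e he => by
        show k * _ * k⁻¹ = 1; rw [hWtree t e he]; group)
    rw [href s k, href s' k']
    have h0 : (0 : ℝ) ≤ ∑ y : Site 3 L, ‖su2Quat (k * (lam y * C₀) * k⁻¹) - su2Quat (k' * (lam y * C₀) * k'⁻¹)‖ ^ 2 := by positivity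
    have h1 := Finset.single_le_sum (f := fun i : Fin (2 * L - 1 + 1) => ∑ e : Edge 3 L,
        ‖su2Quat ((fun _ : Fin (2 * L - 1 + 1) => gaugeTransform (fun _ : Site 3 L => k) (combFlat (fun a => centreElem (s a) * (if z a then N₀ else 1)))) i e) -
          su2Quat ((fun _ : Fin (2 * L - 1 + 1) => gaugeTransform (fun _ : Site 3 L => k') (combFlat (fun a => centreElem (s' a) * (if z a then N₀ else 1)))) i e)‖ ^ 2)
      (fun _ _ => by positivity) (Finset.mem_univ (0 : Fin (2 * L - 1 + 1)))
    have h2 : 4 ≤ ∑ e : Edge 3 L,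
        ‖su2Quat ((fun _ : Fin (2 * L - 1 + 1) => gaugeTransform (fun _ : Site 3 L => k) (combFlat (fun a => centreElem (s a) * (if z a then N₀ else 1)))) 0 e) -
          su2Quat ((fun _ : Fin (2 * L - 1 + 1) => gaugeTransform (fun _ : Site 3 L => k') (combFlat (fun a => centreElem (s' a) * (if z a then N₀ else 1)))) 0 e)‖ ^ 2 := by
      have h4 := four_le_ringDistSq_reference_conj (L := L) z hk₀ (N₀ := N₀) hss' hsk₀ (k⁻¹ * k')
      refine h4.trans (le_of_eq (Finset.sum_congr rfl fun e _ => ?_))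
      show _ = ‖su2Quat (k * _ * k⁻¹) - su2Quat (k' * _ * k'⁻¹)‖ ^ 2
      rw [← norm_su2Quat_conj_sub_conj k⁻¹ (k * _ * k⁻¹) (k' * _ * k'⁻¹)]
      congr 3
      · group
      · rw [mul_inv_rev, inv_inv]; group
    linarith
  -- the two memberships are incompatible
  rw [Set.disjoint_left]
  rintro x ⟨⟨k, v⟩, ⟨-, hv⟩, rfl⟩ ⟨⟨k', v'⟩, ⟨-, hv'⟩, heq⟩
  rw [mem_closedBall_zero_iff] at hv hv'
  dsimp only at heq
  have h1 := hrad s k v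
  have h2 := hrad s' k' v'
  rw [heq] at h2
  have h3 := hsep k k'
  have h4 := htri (Q s k) _ (Q s' k') |>.trans (add_le_add (mul_le_mul_of_nonneg_left ((hsymm _ _).trans_le h1) (by norm_num))
    (mul_le_mul_of_nonneg_left h2 (by norm_num)))
  have hv0 : 0 ≤ RV := (norm_nonneg v).trans hv
  nlinarith [pow_le_pow_left₀ (norm_nonneg v) hv 2, pow_le_pow_left₀ (norm_nonneg v') hv' 2]

end Summit.QuantumFields.YangMills.Theorems.VirialFluxGap.AnchorSlice
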